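/-
Copyright (c) 2026. All rights reserved.
Released under Apache 2.0 license as described in the file LICENSE.
Authors: abc-iut cell, seat abc-iut-w5-d053 (gen 4; row «COR37-LOGOBS-GLUE», part (b) of abc-iut-L4-t5's
«COR37-COMPAT-LITERAL» split — the boundary set of the glued family).
-/
import Literature.AnabelianGeometry.AbsoluteAnabelian.AbsTopIII.BiAnabelianCompatibilityGlue
import Literature.AnabelianGeometry.AbsoluteAnabelian.AbsTopIII.MonoAnabelianComparisonShapesPaths
import HarnessLib

/-!
# [AbsTopIII] Cor 3.7 (iii), second clause — the BOUNDARY SET of the family on `𝒟*` gluing the cores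
# with the observable `𝔖†_log`: normal form and saturation

S. Mochizuki, *Topics in absolute anabelian geometry III* [MochizukiAbsTopIII2015] (kurims manuscript
`paper:url-5493eb38cbb7`), Cor 3.7 (iii) p. 88 ("[the family of `𝔖†_log`] is compatible with the families of
homotopies that constitute the core and telecore structures of (i), (ii)"), Def 3.5 (ii) p. 75 (compatible
families: contained in ONE family), §0 p. 26 (saturated sets), proof of Cor 3.6 (iii) p. 81 (the cells of
`E_log`).

PURE COMBINATORICS on the oriented graph `Γ⃗_{𝒟*}` (abc-iut-L4-t2's `Cor37Vertex`/`Cor37Edge`; no setting,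
no category): the boundary set `GlueE` of the family of abc-iut-L4-t5's plan (memo
`HOME/staging/L4/L4-t5/DISCHARGE-PLAN-Cor37-compat.md` §UPDATE, normal form «𝒳-pair THEN cell») that is to
contain abc-iut-L4-t5's core family `K₁` (`glueFamily`, pairs through `𝔈` or through the reference vertex
`𝒳 = ref`) AND the cells of `𝔖†_log` (abc-iut-L4-t9 lineage's `ObsCell`, read on `𝒟*` with arbitrary
prefixes).  Normal form by the LAST VISIT to `ref` (the device of abc-iut-w6-d025's `tele_decomp_unique` for
Cor 3.6): a pair `(P, R)` of co-terminal paths lies in `GlueE` iff `P = R`, or both end at `𝔈`, or NEITHER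
visits `ref` and `(P, R)` is a cell pair, or BOTH visit `ref` and their ref-free tails after the last visit
are equal or form a cell pair.  This file: the definitions (`refCount`, `VisitsRef`, `RefSplit`, `StarCell`,
`GlueE`) and the combinatorial lemmas (unique split at the last visit, dichotomy of cells); saturation
(`isSaturated_glueE`) is `BiAnabelianLogGlueSaturated.lean`, the homotopies and the closer
`logObsCompatCoresStmt_of_iotaOverGal` follow in `BiAnabelianLogGlueEta.lean` / `…Family.lean`.

HONEST FRAMING: bookkeeping over the cell's typing of refereed pre-IUT material; nothing here bears on
[IUTchIII] Cor. 3.12; no `Prop` fact, no instance.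
-/

set_option autoImplicit false

namespace Literature.AnabelianGeometry.AbsoluteAnabelian.AbsTopIII

open Quiver

universe w

namespace StarGlue

/-! ## Visits to the reference vertex `ref` -/

/-- The number of vertices of a path AFTER its start that equal `ref`.
[cite: MochizukiAbsTopIII2015, Cor 3.7 (ii) p.87] -/
def refCount {a : Cor37Vertex} : ∀ {b : Cor37Vertex}, StarPath.{w} a b → ℕ
  | _, Path.nil => 0
  | b, Path.cons t _ => refCount t + if b = Cor37Vertex.ref then 1 else 0

/-- `refCount` of `nil`. [cite: MochizukiAbsTopIII2015, Cor 3.7 (ii) p.87] -/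
@[simp] theorem refCount_nil (a : Cor37Vertex) : refCount (Path.nil : StarPath.{w} a a) = 0 := rfl

/-- `refCount` of a `cons`. [cite: MochizukiAbsTopIII2015, Cor 3.7 (ii) p.87] -/
@[simp] theorem refCount_cons {a b c : Cor37Vertex} (t : StarPath.{w} a b) (e : Cor37Edge.{w} b c) :
    refCount (t.cons e) = refCount t + if c = Cor37Vertex.ref then 1 else 0 := rfl

/-- `refCount` is additive under composition. [cite: MochizukiAbsTopIII2015, Cor 3.7 (ii) p.87] -/
theorem refCount_comp {a b : Cor37Vertex} (p : StarPath.{w} a b) :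
    ∀ {c : Cor37Vertex} (q : StarPath.{w} b c), refCount (p.comp q) = refCount p + refCount q
  | _, Path.nil => by simp
  | _, Path.cons q e => by rw [Path.comp_cons, refCount_cons, refCount_cons, refCount_comp p q]; omega

/-- A path VISITS `ref` if it starts there or passes through it.
[cite: MochizukiAbsTopIII2015, Cor 3.7 (ii) p.87] -/
def VisitsRef {a b : Cor37Vertex} (P : StarPath.{w} a b) : Prop := a = Cor37Vertex.ref ∨ 0 < refCount P

/-- Visiting `ref` is inherited by post-composites. [cite: MochizukiAbsTopIII2015, Cor 3.7 (ii) p.87] -/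
theorem VisitsRef.comp_right {a b c : Cor37Vertex} {P : StarPath.{w} a b} (h : VisitsRef P) (q : Path b c) :
    VisitsRef (P.comp q) := by
  rcases h with h | h
  · exact Or.inl h
  · exact Or.inr (by rw [refCount_comp]; omega)

/-- A pre-composite visits `ref` iff the prefix or the suffix does (the junction counted with the suffix's
start). [cite: MochizukiAbsTopIII2015, Cor 3.7 (ii) p.87] -/
theorem visitsRef_comp_iff {a b c : Cor37Vertex} (r : StarPath.{w} a b) (P : StarPath.{w} b c) :
    VisitsRef (r.comp P) ↔ VisitsRef r ∨ VisitsRef P := by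
  constructor
  · rintro (h | h)
    · exact Or.inl (Or.inl h)
    · rw [refCount_comp] at h
      by_cases hr : 0 < refCount r
      · exact Or.inl (Or.inr hr)
      · exact Or.inr (Or.inr (by omega))
  · rintro ((h | h) | (h | h))
    · exact Or.inl h
    · exact Or.inr (by rw [refCount_comp]; omega)
    · -- `b = ref`: the prefix `r` ends at `ref`
      subst h
      cases r with
      | nil => exact Or.inl rfl
      | cons t e => exact Or.inr (by rw [refCount_comp, refCount_cons]; simp; omega)
    · exact Or.inr (by rw [refCount_comp]; omega)

/-- A path ending at `ref` visits `ref`. [cite: MochizukiAbsTopIII2015, Cor 3.7 (ii) p.87] -/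
theorem visitsRef_of_end {a : Cor37Vertex} (P : StarPath.{w} a Cor37Vertex.ref) : VisitsRef P := by
  cases P with
  | nil => exact Or.inl rfl
  | cons t e => exact Or.inr (by rw [refCount_cons]; simp)

/-! ## The split at the last visit to `ref` -/

/-- A SPLIT of `P` at its last visit to `ref`: `P = P⁺ · P⁰` with `P⁰` never returning to `ref`.
[cite: MochizukiAbsTopIII2015, Cor 3.7 (ii) p.87] -/
structure RefSplit {a b : Cor37Vertex} (P : StarPath.{w} a b) : Type w where
  /-- the prefix up to the last visit -/
  head : StarPath.{w} a Cor37Vertex.ref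
  /-- the ref-free tail -/
  tail : StarPath.{w} Cor37Vertex.ref b
  eq : P = head.comp tail
  free : refCount tail = 0

/-- Existence of the split for a path visiting `ref`. [cite: MochizukiAbsTopIII2015, Cor 3.7 (ii) p.87] -/
theorem nonempty_refSplit {a : Cor37Vertex} :
    ∀ {b : Cor37Vertex} (P : StarPath.{w} a b), VisitsRef P → Nonempty (RefSplit P)
  | _, Path.nil, h => by
    rcases h with h | h
    · subst h; exact ⟨⟨Path.nil, Path.nil, rfl, rfl⟩⟩
    · simp at h
  | b, Path.cons t e, h => by
    by_cases hb : b = Cor37Vertex.ref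
    · subst hb
      exact ⟨⟨t.cons e, Path.nil, rfl, rfl⟩⟩
    · have ht : VisitsRef t := by
        rcases h with h | h
        · exact Or.inl h
        · rw [refCount_cons, if_neg hb] at h
          exact Or.inr (by omega)
      obtain ⟨⟨hd, tl, heq, hfree⟩⟩ := nonempty_refSplit t ht
      refine ⟨⟨hd, tl.cons e, by rw [heq, Path.comp_cons], ?_⟩⟩
      rw [refCount_cons, hfree, if_neg hb]

/-- Uniqueness of the split (the last visit is the last visit): two decompositions with ref-free tails agree.
[cite: MochizukiAbsTopIII2015, Cor 3.7 (ii) p.87] -/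
theorem split_unique {a : Cor37Vertex} (h₁ h₂ : StarPath.{w} a Cor37Vertex.ref) :
    ∀ {b : Cor37Vertex} (t₁ t₂ : StarPath.{w} Cor37Vertex.ref b),
      h₁.comp t₁ = h₂.comp t₂ → refCount t₁ = 0 → refCount t₂ = 0 → h₁ = h₂ ∧ t₁ = t₂
  | _, Path.nil, t₂, he, _, f₂ => by
    cases t₂ with
    | nil => simpa using he
    | cons t e => simp at f₂
  | _, Path.cons t e, Path.nil, _, f₁, _ => by simp at f₁
  | _, Path.cons t e, Path.cons t' e', he, f₁, f₂ => by
    rw [Path.comp_cons, Path.comp_cons] at he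
    obtain rfl := Path.obj_eq_of_cons_eq_cons he
    have hee := eq_of_heq (Path.hom_heq_of_cons_eq_cons he)
    have hpp := eq_of_heq (Path.heq_of_cons_eq_cons he)
    rw [refCount_cons] at f₁ f₂
    obtain ⟨hh, htt⟩ := split_unique h₁ h₂ t t' hpp (by omega) (by omega)
    exact ⟨hh, by rw [htt, hee]⟩

/-- Any two splits of the same path coincide. [cite: MochizukiAbsTopIII2015, Cor 3.7 (ii) p.87] -/
theorem RefSplit.unique {a b : Cor37Vertex} {P : StarPath.{w} a b} (S T : RefSplit P) :
    S.head = T.head ∧ S.tail = T.tail :=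
  split_unique S.head T.head S.tail T.tail (S.eq.symm.trans T.eq) S.free T.free

/-- The split of a ref-free post-extension: `(P · e)⁰ = P⁰ · e` when the new endpoint is not `ref`.
[cite: MochizukiAbsTopIII2015, Cor 3.7 (ii) p.87] -/
def RefSplit.consOfNe {a b c : Cor37Vertex} {P : StarPath.{w} a b} (S : RefSplit P) (e : Cor37Edge.{w} b c)
    (hc : c ≠ Cor37Vertex.ref) : RefSplit (P.cons e) where
  head := S.head
  tail := S.tail.cons e
  eq := by rw [Path.comp_cons, ← S.eq]
  free := by rw [refCount_cons, S.free, if_neg hc]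

/-- The split of a pre-composite `r · P` when `P` itself visits `ref`: same tail, longer head.
[cite: MochizukiAbsTopIII2015, Cor 3.7 (ii) p.87] -/
def RefSplit.precomp {a b c : Cor37Vertex} {P : StarPath.{w} a b} (S : RefSplit P) (r : StarPath.{w} c a) :
    RefSplit (r.comp P) where
  head := r.comp S.head
  tail := S.tail
  eq := by rw [Path.comp_assoc, ← S.eq]
  free := S.free

/-! ## Cells of `𝔖†_log` read on `𝒟*` (arbitrary prefixes) -/

/-- A CELL from the vertex `x`: type (3) `refl r e` (the reflexive pair of `[e]∘[r]`, `e ∈ {λ^×, λ^{×pf}}`),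
type (2) `times r` = `([λ^×]∘[r], [λ^{×pf}]∘[r])`, type (1) `log n r` = `([λ^×]∘[pr_⋎]∘[log_𝒳]∘[r],
[λ^{×pf}]∘[pr_{⋎+1}]∘[r])` with `⋎ = n` — abc-iut-L4-t9 lineage's `ObsCell`, but with prefix `r` an arbitrary
path of `Γ⃗_{𝒟*}` (it may pass through `ref`). All cells end at `𝒩`. [cite: MochizukiAbsTopIII2015, Cor 3.7 (iii) p.88] -/
inductive StarCell (x : Cor37Vertex) : Type w
  | refl (r : StarPath.{w} x Cor37Vertex.box) (e : Cor37Edge.{w} Cor37Vertex.box Cor37Vertex.space) : StarCell x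
  | times (r : StarPath.{w} x Cor37Vertex.box) : StarCell x
  | log (n : ℤ) (r : StarPath.{w} x (Cor37Vertex.first (n + 1))) : StarCell x

namespace StarCell

variable {x : Cor37Vertex}

/-- The left path of a cell. [cite: MochizukiAbsTopIII2015, Cor 3.7 (iii) p.88] -/
def left : StarCell.{w} x → StarPath.{w} x Cor37Vertex.space
  | refl r e => r.cons e
  | times r => r.cons Cor37Edge.lamTimes
  | log n r => ((r.cons (Cor37Edge.log (n + 1) n rfl)).cons (Cor37Edge.pr n)).cons Cor37Edge.lamTimes

/-- The right path of a cell. [cite: MochizukiAbsTopIII2015, Cor 3.7 (iii) p.88] -/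
def right : StarCell.{w} x → StarPath.{w} x Cor37Vertex.space
  | refl r e => r.cons e
  | times r => r.cons Cor37Edge.lamTimesPf
  | log n r => (r.cons (Cor37Edge.pr (n + 1))).cons Cor37Edge.lamTimesPf

/-- Prefixing a cell. [cite: MochizukiAbsTopIII2015, Cor 3.7 (iii) p.88] -/
def precomp {c : Cor37Vertex} (r₀ : StarPath.{w} c x) : StarCell.{w} x → StarCell.{w} c
  | refl r e => refl (r₀.comp r) e
  | times r => times (r₀.comp r)
  | log n r => log n (r₀.comp r)

/-- [cite: MochizukiAbsTopIII2015, Cor 3.7 (iii) p.88] -/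
@[simp] theorem left_precomp {c : Cor37Vertex} (r₀ : StarPath.{w} c x) (g : StarCell.{w} x) :
    (g.precomp r₀).left = r₀.comp g.left := by
  cases g <;> simp [precomp, left, Path.comp_cons]

/-- [cite: MochizukiAbsTopIII2015, Cor 3.7 (iii) p.88] -/
@[simp] theorem right_precomp {c : Cor37Vertex} (r₀ : StarPath.{w} c x) (g : StarCell.{w} x) :
    (g.precomp r₀).right = r₀.comp g.right := by
  cases g <;> simp [precomp, right, Path.comp_cons]

/-- The reflexive cell with the same left path as `g`. [cite: MochizukiAbsTopIII2015, Cor 3.7 (iii) p.88] -/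
def reflLeft : StarCell.{w} x → StarCell.{w} x
  | refl r e => refl r e
  | times r => refl r Cor37Edge.lamTimes
  | log n r => refl ((r.cons (Cor37Edge.log (n + 1) n rfl)).cons (Cor37Edge.pr n)) Cor37Edge.lamTimes

/-- The reflexive cell with the same right path as `g`. [cite: MochizukiAbsTopIII2015, Cor 3.7 (iii) p.88] -/
def reflRight : StarCell.{w} x → StarCell.{w} x
  | refl r e => refl r e
  | times r => refl r Cor37Edge.lamTimesPf
  | log n r => refl (r.cons (Cor37Edge.pr (n + 1))) Cor37Edge.lamTimesPf

/-- [cite: MochizukiAbsTopIII2015, Cor 3.7 (iii) p.88] -/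
@[simp] theorem reflLeft_left (g : StarCell.{w} x) : g.reflLeft.left = g.left := by cases g <;> rfl
/-- [cite: MochizukiAbsTopIII2015, Cor 3.7 (iii) p.88] -/
@[simp] theorem reflLeft_right (g : StarCell.{w} x) : g.reflLeft.right = g.left := by cases g <;> rfl
/-- [cite: MochizukiAbsTopIII2015, Cor 3.7 (iii) p.88] -/
@[simp] theorem reflRight_left (g : StarCell.{w} x) : g.reflRight.left = g.right := by cases g <;> rfl
/-- [cite: MochizukiAbsTopIII2015, Cor 3.7 (iii) p.88] -/
@[simp] theorem reflRight_right (g : StarCell.{w} x) : g.reflRight.right = g.right := by cases g <;> rfl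

/-- `refCount` of the left path = that of the right path (the two sides of a cell visit `ref` equally
often: they share the prefix, and the differing tails avoid `ref`). [cite: MochizukiAbsTopIII2015, Cor 3.7 (iii) p.88] -/
theorem refCount_left_eq_right (g : StarCell.{w} x) : refCount g.left = refCount g.right := by
  cases g <;> simp [left, right]

/-- The two sides of a cell visit `ref` simultaneously. [cite: MochizukiAbsTopIII2015, Cor 3.7 (iii) p.88] -/
theorem visitsRef_left_iff (g : StarCell.{w} x) : VisitsRef g.left ↔ VisitsRef g.right := by
  unfold VisitsRef; rw [refCount_left_eq_right]

/-- **Dichotomy** (abc-iut-L4-t9 lineage's `ObsCell.dichotomy` on `𝒟*`): if the right path of `g` is the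
left path of `g'`, one of the two cells is reflexive (right paths of types (1)/(2) end in `λ^{×pf}`, left
paths in `λ^×`). [cite: MochizukiAbsTopIII2015, Cor 3.7 (iii) p.88] -/
theorem dichotomy {g g' : StarCell.{w} x} (e : g.right = g'.left) :
    g.left = g.right ∨ g'.right = g'.left := by
  cases g with
  | refl r f => exact Or.inl rfl
  | times r =>
    cases g' with
    | refl r' f' => exact Or.inr rfl
    | times r' => exact absurd (eq_of_heq (Path.hom_heq_of_cons_eq_cons e)) (fun h => by cases h)
    | log n' r' => exact absurd (eq_of_heq (Path.hom_heq_of_cons_eq_cons e)) (fun h => by cases h)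
  | log n r =>
    cases g' with
    | refl r' f' => exact Or.inr rfl
    | times r' => exact absurd (eq_of_heq (Path.hom_heq_of_cons_eq_cons e)) (fun h => by cases h)
    | log n' r' => exact absurd (eq_of_heq (Path.hom_heq_of_cons_eq_cons e)) (fun h => by cases h)

end StarCell

/-! ## The boundary set `GlueE` -/

/-- **The boundary set of the glued family on `𝒟*`** (normal form by the last visit to `ref`): `(P, R)`
with `P = R`; or both ending at `𝔈` (all co-terminal pairs into the core vertex `𝔈`); or NEITHER visiting
`ref` and `(P, R)` the two sides of a cell; or BOTH visiting `ref` with ref-free tails (after the last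
visit) that are equal or the two sides of a cell from `ref`.
[cite: MochizukiAbsTopIII2015, Cor 3.7 (iii) p.88] -/
inductive GlueE : ∀ ⦃a b : Cor37Vertex⦄, StarPath.{w} a b → StarPath.{w} a b → Prop
  | rfl {a b : Cor37Vertex} (P : StarPath.{w} a b) : GlueE P P
  | gal {a : Cor37Vertex} (P R : StarPath.{w} a Cor37Vertex.galois) : GlueE P R
  | cell {a : Cor37Vertex} (g : StarCell.{w} a) (hP : ¬ VisitsRef g.left) : GlueE g.left g.right
  | tailEq {a b : Cor37Vertex} (p q : StarPath.{w} a Cor37Vertex.ref) (t : StarPath.{w} Cor37Vertex.ref b)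
      (ht : refCount t = 0) : GlueE (p.comp t) (q.comp t)
  | tailCell {a : Cor37Vertex} (p q : StarPath.{w} a Cor37Vertex.ref) (g : StarCell.{w} Cor37Vertex.ref)
      (hg : refCount g.left = 0) : GlueE (p.comp g.left) (q.comp g.right)


/-! ## Combinatorial lemmas on `Γ⃗_{𝒟*}` -/

/-- An edge out of a vertex of row `≥ 3` ends at `𝔈`. [cite: MochizukiAbsTopIII2015, Cor 3.7 (ii) p.87] -/
theorem eq_galois_of_edge {d c : Cor37Vertex} (e : Cor37Edge.{w} d c) (hd : 3 ≤ d.row) :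
    c = Cor37Vertex.galois := by
  cases e <;> simp [Cor37Vertex.row] at hd ⊢

/-- A non-trivial path out of a vertex of row `≥ 3` (`𝒩` or `𝔈`) ends at `𝔈`.
[cite: MochizukiAbsTopIII2015, Cor 3.7 (ii) p.87] -/
theorem eq_galois_of_path_cons {d b c : Cor37Vertex} (hd : 3 ≤ d.row) (t : StarPath.{w} d b)
    (e : Cor37Edge.{w} b c) : c = Cor37Vertex.galois :=
  eq_galois_of_edge e (le_trans hd (Cor37Vertex.row_le_of_path t))

/-- A path out of `𝔈` ends at `𝔈`. [cite: MochizukiAbsTopIII2015, Cor 3.7 (ii) p.87] -/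
theorem eq_galois_of_path_galois {c : Cor37Vertex} (r : StarPath.{w} Cor37Vertex.galois c) :
    c = Cor37Vertex.galois := by
  have h := Cor37Vertex.row_le_of_path r
  revert h r; cases c <;> simp [Cor37Vertex.row]

/-- `¬ VisitsRef` unfolds to "does not start at `ref` and never passes through it".
[cite: MochizukiAbsTopIII2015, Cor 3.7 (ii) p.87] -/
theorem not_visitsRef_iff {a b : Cor37Vertex} (P : StarPath.{w} a b) :
    ¬ VisitsRef P ↔ a ≠ Cor37Vertex.ref ∧ refCount P = 0 := by
  unfold VisitsRef; constructor
  · intro h; exact ⟨fun ha => h (Or.inl ha), by omega⟩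
  · rintro ⟨ha, h0⟩ (h | h)
    · exact ha h
    · omega

/-- A composite `p · t` with `p` ending at `ref` visits `ref`. [cite: MochizukiAbsTopIII2015, Cor 3.7 (ii) p.87] -/
theorem visitsRef_comp_ref {a b : Cor37Vertex} (p : StarPath.{w} a Cor37Vertex.ref)
    (t : StarPath.{w} Cor37Vertex.ref b) : VisitsRef (p.comp t) :=
  (visitsRef_comp_iff p t).2 (Or.inl (visitsRef_of_end p))

end StarGlue

end Literature.AnabelianGeometry.AbsoluteAnabelian.AbsTopIII
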